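import Summits.AtomisticToContinuum.FouriersLaw.Theorems.ContactStieltjesMeasureStieltjesRepresentationStubHarmonicMemberAux1
import Summits.AtomisticToContinuum.FouriersLaw.Theorems.ContactStieltjesMeasureContactMeasureLimitStubLayerCake
import Literature.MathematicalPhysics.KineticTheory.HarmonicChainNESS
import Literature.Barriers.AtomisticToContinuum.HarmonicCrystalBallistic

/-!
# Stub `stub_harmonicMember` — the harmonic calibration `lam = β = 0` of crux `StieltjesRepresentation`

Line `cayley-pencil` (route `ContactStieltjesMeasure`, sub-problem `FouriersLaw`), registered stub 4a: for the
pinned HARMONIC chain `pinnedChain ω₂ 0 0 γ` (`ω₂ > 0`), every `T > 0` and `N ≥ 2` there is ONE `γ`-free bounded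
monotone `Φ_N` vanishing on `(-∞, 0]` such that, under weak steady-state uniqueness and along every steady
family `μ`, the finite-`N` response quotient `totalCurrent(μ_{N, T+δ/2, T-δ/2})/δ` tends, as `δ → 0`, `δ ≠ 0`, to
`(N - 1) · γ · ∫₀^∞ Φ_N(t) · 2t/(γ² + t²)² dt` for EVERY `γ > 0`.

Proof.
* SPECTRAL half (auxiliary file 1, `HarmonicMember.fluxCoeff_eq_sum_atoms`): `fluxCoeff ω₂ γ N = γ ∑_k c_k/(γ² + s_k²)`
  with `γ`-free `c_k, s_k ≥ 0`, `k < N - 1`; the step function `Φ_N(t) = ∑_k c_k [s_k < t]` is monotone, vanishes on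
  `(-∞, 0]`, is bounded by `∑ c_k`, and `∫₀^∞ Φ_N(t) 2t/(γ²+t²)² dt = ∑_k c_k ∫_{s_k}^∞ 2t/(γ²+t²)² dt = ∑_k c_k/(γ²+s_k²)`
  (kernel primitive `-(γ²+t²)⁻¹`, `ContactMeasureLimit.layerCake_integral_Ioi_kernel`).
* DYNAMICAL half (tree): by uniqueness the steady family is the Gaussian `harmonicNESS` for `|δ| < 2T`
  (`isSteadyState_harmonicNESS`), each proper bond carries `fluxCoeff ω₂ γ N · δ`
  (`integral_bondCurrent_harmonicNESS_eq_fluxCoeff'`), so the quotient is eventually the constant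
  `(N-1) · fluxCoeff ω₂ γ N` on `𝓝[≠] 0` (`OscillatorChain.totalCurrent_eq_of_forall`).
-/

noncomputable section

open scoped NNReal ENNReal Topology BigOperators
open MeasureTheory Filter Set
open Literature.MathematicalPhysics.KineticTheory.HeatConduction

namespace Summit.AtomisticToContinuum.FouriersLaw.Theorems.ContactStieltjesMeasure.CayleyPencil

namespace HarmonicMember

/-! ## Layer cake for finitely many atoms -/

/-- A finite atomic step function `t ↦ ∑_k c_k [s_k < t]` with `c_k ≥ 0` is monotone. -/
theorem atoms_monotone {m : ℕ} (c s : Fin m → ℝ) (hc : ∀ k, 0 ≤ c k) :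
    Monotone fun t : ℝ => ∑ k, if s k < t then c k else 0 := by
  intro t₁ t₂ ht
  refine Finset.sum_le_sum fun k _ => ?_
  by_cases h1 : s k < t₁
  · rw [if_pos h1, if_pos (lt_of_lt_of_le h1 ht)]
  · rw [if_neg h1]
    split_ifs
    · exact hc k
    · exact le_rfl

/-- With `s_k ≥ 0` the step function vanishes on `(-∞, 0]`. -/
theorem atoms_eq_zero_of_nonpos {m : ℕ} (c s : Fin m → ℝ) (hs : ∀ k, 0 ≤ s k) {t : ℝ} (ht : t ≤ 0) :
    (∑ k, if s k < t then c k else 0) = 0 :=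
  Finset.sum_eq_zero fun k _ => if_neg (not_lt.mpr (ht.trans (hs k)))

/-- The step function is bounded by its total mass `∑ c_k`. -/
theorem atoms_le_sum {m : ℕ} (c s : Fin m → ℝ) (hc : ∀ k, 0 ≤ c k) (t : ℝ) :
    (∑ k, if s k < t then c k else 0) ≤ ∑ k, c k :=
  Finset.sum_le_sum fun k _ => by
    split_ifs
    · exact le_rfl
    · exact hc k

/-- **Layer cake for atoms**: for `γ > 0` and `s_k ≥ 0`,
`∫_(0,∞) (∑_k c_k [s_k < t]) · 2t/(γ²+t²)² dt = ∑_k c_k/(γ² + s_k²)`. -/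
theorem integral_atoms_mul_kernel {m : ℕ} (c s : Fin m → ℝ) (hs : ∀ k, 0 ≤ s k) {γ : ℝ} (hγ : 0 < γ) :
    ∫ t in Ioi (0 : ℝ), (∑ k, if s k < t then c k else 0) * (2 * t / (γ ^ 2 + t ^ 2) ^ 2) =
      ∑ k, c k / (γ ^ 2 + s k ^ 2) := by
  have hind : ∀ (k : Fin m) (t : ℝ), (if s k < t then c k else 0) * (2 * t / (γ ^ 2 + t ^ 2) ^ 2) =
      (Ioi (s k)).indicator (fun t => c k * (2 * t / (γ ^ 2 + t ^ 2) ^ 2)) t := by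
    intro k t
    by_cases h : s k < t
    · rw [if_pos h, indicator_of_mem (mem_Ioi.mpr h)]
    · rw [if_neg h, indicator_of_notMem (fun h' => h (mem_Ioi.mp h')), zero_mul]
  have hker := fun k => ContactMeasureLimit.layerCake_integral_Ioi_kernel hγ (hs k)
  have hint : ∀ k, Integrable ((Ioi (s k)).indicator (fun t => c k * (2 * t / (γ ^ 2 + t ^ 2) ^ 2)))
      (volume.restrict (Ioi 0)) := by
    intro k
    rw [integrable_indicator_iff measurableSet_Ioi, IntegrableOn,
      Measure.restrict_restrict measurableSet_Ioi, Ioi_inter_Ioi, sup_eq_left.mpr (hs k)]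
    exact (hker k).1.const_mul (c k)
  simp_rw [Finset.sum_mul, hind]
  rw [integral_finsetSum _ (fun k _ => hint k)]
  refine Finset.sum_congr rfl fun k _ => ?_
  rw [setIntegral_indicator measurableSet_Ioi, Ioi_inter_Ioi, sup_eq_right.mpr (hs k),
    integral_const_mul, (hker k).2, div_eq_mul_inv]

/-- **The spectral half**: for `ω₂ > 0`, `N ≥ 2` a `γ`-free bounded monotone `Φ_N` vanishing on `(-∞,0]` with
`fluxCoeff ω₂ γ N = γ ∫₀^∞ Φ_N(t) 2t/(γ²+t²)² dt` for every `γ > 0`. -/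
theorem fluxCoeff_stieltjes {ω₂ : ℝ} (hω : 0 < ω₂) {N : ℕ} (hN : 2 ≤ N) :
    ∃ Φ : ℝ → ℝ, Monotone Φ ∧ (∀ s : ℝ, s ≤ 0 → Φ s = 0) ∧ (∃ m : ℝ, ∀ s : ℝ, Φ s ≤ m) ∧
      ∀ γ : ℝ, 0 < γ →
        fluxCoeff ω₂ γ N = γ * ∫ t in Set.Ioi (0 : ℝ), Φ t * (2 * t / (γ ^ 2 + t ^ 2) ^ 2) := by
  obtain ⟨c, s, hc, hs, hflux⟩ := fluxCoeff_eq_sum_atoms hω hN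
  refine ⟨fun t => ∑ k, if s k < t then c k else 0, atoms_monotone c s hc,
    fun t ht => atoms_eq_zero_of_nonpos c s hs ht, ⟨∑ k, c k, atoms_le_sum c s hc⟩, fun γ hγ => ?_⟩
  rw [hflux γ hγ, integral_atoms_mul_kernel c s hs hγ]

/-! ## The dynamical half and the clause for fixed `N` -/

/-- **The crux clause at the harmonic member, fixed `N ≥ 2`.** Under weak-NESS uniqueness the steady family is
`harmonicNESS` for `|δ| < 2T`, the response quotient is eventually the constant `(N-1) · fluxCoeff ω₂ γ N`, and
`fluxCoeff ω₂ γ N = γ ∫₀^∞ Φ_N 2t/(γ²+t²)²` by `fluxCoeff_stieltjes`. -/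
theorem clause_fixedN {ω₂ : ℝ} (hω : 0 < ω₂) {T : ℝ} (hT : 0 < T) (N : ℕ) (hN : 2 ≤ N) :
    ∃ ΦN : ℝ → ℝ, Monotone ΦN ∧ (∀ s : ℝ, s ≤ 0 → ΦN s = 0) ∧ (∃ m : ℝ, ∀ s : ℝ, ΦN s ≤ m) ∧
      ∀ γ : ℝ, 0 < γ →
        (∀ (N' : ℕ) (T_L T_R : ℝ), 0 < T_L → 0 < T_R → ∀ μ ν : Measure (PhaseSpace N'),
          (pinnedChain ω₂ 0 0 γ).IsSteadyState N' T_L T_R μ →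
          (pinnedChain ω₂ 0 0 γ).IsSteadyState N' T_L T_R ν → μ = ν) →
        ∀ μ : (N' : ℕ) → ℝ → ℝ → Measure (PhaseSpace N'),
          (∀ (N' : ℕ) (T_L T_R : ℝ), 0 < T_L → 0 < T_R →
            (pinnedChain ω₂ 0 0 γ).IsSteadyState N' T_L T_R (μ N' T_L T_R)) →
          Tendsto (fun δ : ℝ => (pinnedChain ω₂ 0 0 γ).totalCurrent (μ N (T + δ / 2) (T - δ / 2)) / δ)
            (𝓝[≠] 0)
            (𝓝 (((N : ℝ) - 1) * γ * ∫ t in Set.Ioi (0 : ℝ), ΦN t * (2 * t / (γ ^ 2 + t ^ 2) ^ 2))) := by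
  obtain ⟨Φ, hmono, hzero, hbd, hflux⟩ := fluxCoeff_stieltjes hω hN
  refine ⟨Φ, hmono, hzero, hbd, fun γ hγ hU μ hμ => ?_⟩
  obtain ⟨M, rfl⟩ : ∃ M, N = M + 1 := ⟨N - 1, by omega⟩
  set P := pinnedChain ω₂ 0 0 γ with hP
  have hconst : ∀ᶠ δ in 𝓝[≠] (0 : ℝ),
      P.totalCurrent (μ (M + 1) (T + δ / 2) (T - δ / 2)) / δ = M * fluxCoeff ω₂ γ (M + 1) := by
    have h2 : ∀ᶠ δ in 𝓝 (0 : ℝ), δ < 2 * T := eventually_lt_nhds (by linarith)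
    have h2' : ∀ᶠ δ in 𝓝 (0 : ℝ), -(2 * T) < δ := eventually_gt_nhds (by linarith)
    have hne : ∀ᶠ δ in 𝓝[≠] (0 : ℝ), δ ≠ 0 := eventually_mem_nhdsWithin
    filter_upwards [mem_nhdsWithin_of_mem_nhds h2, mem_nhdsWithin_of_mem_nhds h2', hne]
      with δ hlt hgt hδ
    have hδ' : δ ≠ 0 := by simpa using hδ
    have ha : 0 < T + δ / 2 := by linarith
    have hb : 0 < T - δ / 2 := by linarith
    -- uniqueness: the steady family is the Gaussian NESS
    have hμeq : μ (M + 1) (T + δ / 2) (T - δ / 2) = harmonicNESS ω₂ γ (M + 1) (T + δ / 2) (T - δ / 2) :=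
      hU (M + 1) _ _ ha hb _ _ (hμ (M + 1) _ _ ha hb) (isSteadyState_harmonicNESS hω hγ (M + 1) ha hb)
    rw [hμeq, P.totalCurrent_eq_of_forall _ (fluxCoeff ω₂ γ (M + 1) * δ)]
    · rw [← mul_assoc, mul_div_cancel_right₀ _ hδ']
    · intro i hi
      rw [hP, integral_bondCurrent_harmonicNESS_eq_fluxCoeff' hω hγ ha hb i hi]
      ring
  have hval : (((M + 1 : ℕ) : ℝ) - 1) * γ * ∫ t in Set.Ioi (0 : ℝ), Φ t * (2 * t / (γ ^ 2 + t ^ 2) ^ 2) =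
      M * fluxCoeff ω₂ γ (M + 1) := by
    rw [hflux γ hγ]
    push_cast
    ring
  rw [hval]
  exact tendsto_const_nhds.congr' (hconst.mono fun δ hδ => hδ.symm)

end HarmonicMember

/-- **STUB 4a `stub_harmonicMember` (harmonic calibration `lam = β = 0`)** of line `cayley-pencil` for crux
`StieltjesRepresentation`: for the pinned harmonic chain `pinnedChain ω₂ 0 0 γ` (`ω₂ > 0`), `T > 0`, there is
ONE `γ`-free family of bounded monotone `Φ_N` vanishing on `(-∞,0]` (`N - 1` explicit atoms: the spectral
decomposition of the Jacobi matrix `(-Δ_free) + E₀₀` on `N - 1` sites) such that under weak-NESS uniqueness,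
along every steady family, the response quotient tends to `(N-1) γ ∫₀^∞ Φ_N(t) 2t/(γ²+t²)² dt` for every
`γ > 0` (Rieder–Lebowitz–Lieb 1967; Nakazawa 1970; Roy–Dhar 2008 §2 eq. (2.8) for the closed form of the flux). -/
theorem stub_harmonicMember :
    ∀ ω₂ : ℝ, 0 < ω₂ → ∀ T : ℝ, 0 < T →
      ∃ Φ : ℕ → ℝ → ℝ, ∀ N : ℕ, 2 ≤ N → Monotone (Φ N) ∧ (∀ s : ℝ, s ≤ 0 → Φ N s = 0) ∧
        (∃ m : ℝ, ∀ s : ℝ, Φ N s ≤ m) ∧ ∀ γ : ℝ, 0 < γ →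
          (∀ (N' : ℕ) (T_L T_R : ℝ), 0 < T_L → 0 < T_R → ∀ μ ν : Measure (PhaseSpace N'),
            (pinnedChain ω₂ 0 0 γ).IsSteadyState N' T_L T_R μ →
            (pinnedChain ω₂ 0 0 γ).IsSteadyState N' T_L T_R ν → μ = ν) →
          ∀ μ : (N' : ℕ) → ℝ → ℝ → Measure (PhaseSpace N'),
            (∀ (N' : ℕ) (T_L T_R : ℝ), 0 < T_L → 0 < T_R →
              (pinnedChain ω₂ 0 0 γ).IsSteadyState N' T_L T_R (μ N' T_L T_R)) →
            Tendsto (fun δ : ℝ => (pinnedChain ω₂ 0 0 γ).totalCurrent (μ N (T + δ / 2) (T - δ / 2)) / δ)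
              (𝓝[≠] 0)
              (𝓝 (((N : ℝ) - 1) * γ * ∫ t in Set.Ioi (0 : ℝ), Φ N t * (2 * t / (γ ^ 2 + t ^ 2) ^ 2))) := by
  intro ω₂ hω T hT
  have key := fun (N : ℕ) (hN : 2 ≤ N) => HarmonicMember.clause_fixedN hω hT N hN
  classical
  refine ⟨fun N => if hN : 2 ≤ N then Classical.choose (key N hN) else fun _ => 0, fun N hN => ?_⟩
  simp only [dif_pos hN]
  exact Classical.choose_spec (key N hN)

end Summit.AtomisticToContinuum.FouriersLaw.Theorems.ContactStieltjesMeasure.CayleyPencil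

end
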